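import Literature.NumberTheory.LFunctions.RudnickSarnakNMoments
import Literature.NumberTheory.LFunctions.RudnickSarnakNWindow
import Literature.NumberTheory.LFunctions.RudnickSarnakNTestDecay
import Literature.NumberTheory.LFunctions.ZeroPairExchange
import HarnessLib

/-!
# Rudnick–Sarnak `n`-level correlations for `ζ`: unsmoothing the `t`-window

Sibling file of `Literature/NumberTheory/LFunctions/RudnickSarnak.lean` (toward
`Literature.NumberTheory.LFunctions.rudnick_sarnak_unrestricted`, Rudnick–Sarnak 1996, Theorem 3.2
for `ζ`, at every level; back end). Rudnick–Sarnak 1996, pp. 302–303: "We first show that in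
Theorem 3.1 we can take `h_j` to be the characteristic function of the interval" — here, in the
`t`-windowed form of the front end, the statement is that the windowed sum
`W_Φ(T) = Σ_{m ∈ ℕⁿ} f_Φ(Lγ_m/2π) K_T(γ_m)` (`RudnickSarnakN.zeroSideSum`) and the sharp sum in the
same normalisation,

  `S'_Φ(T) = Σ_{m ∈ [0, N(T))ⁿ} f_Φ(Lγ_m/2π)`   (`RudnickSarnakN.Unsmooth.sharpL`),

satisfy `W_Φ(T) = c S'_Φ(T) + o(T log T)` with `c = ∫ κⁿ` (`RudnickSarnakN.Unsmooth.cLim`):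
`RudnickSarnakN.Unsmooth.norm_zeroSideSum_sub_cLim_mul_sharpL_le`. The proof runs over the finite
box `[0, N(T)) × [0, N(T+3))^k` of index tuples: tuples that are not clustered at scale `ρ` around
their first member are negligible by the decay of `f_Φ` and the key lemma of
`RudnickSarnakNMoments.lean`; clustered tuples with first member near `0` or `T` are few; on the
remaining tuples the window is the constant `c(R)` up to a small error (`RudnickSarnakNWindow.lean`);
and the zeros above `T + 3` do not see the window at all.

## References

* Z. Rudnick, P. Sarnak, *Zeros of principal `L`-functions and random matrix theory*, Duke Math.
  J. 81 (1996), 269–322, Thm. 3.2, pp. 302–304.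
-/

noncomputable section

open Complex Filter Set MeasureTheory Finset
open scoped Real Topology ContDiff

namespace Literature.NumberTheory.LFunctions

namespace RudnickSarnakN

namespace Unsmooth

variable {k : ℕ}

/-! ## The summands, the boxes, the sharp sum -/

/-- The test factor of the summand at the tuple `m`: `f_Φ(Lγ_m/2π)`. [cite: RudnickSarnak1996, (3.3)] -/
def fT (Φ : (Fin (k + 1) → ℝ) → ℂ) (T : ℝ) (m : Fin (k + 1) → ℕ) : ℂ :=
  rsPhiTest Φ (fun j ↦ Real.log T * zetaOrdinate (m j) / (2 * π))

/-- The window of the tuple `m`: `K_T(γ_m)`. [cite: RudnickSarnak1996, (3.11)] -/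
def KT (T : ℝ) (m : Fin (k + 1) → ℕ) : ℝ := winKer T (ordTuple m)

/-- The box `[0, N)ⁿ` of index tuples. [folklore] -/
def box (k N : ℕ) : Finset (Fin (k + 1) → ℕ) := Fintype.piFinset fun _ : Fin (k + 1) ↦ Finset.range N

/-- The working box `[0, N(T)) × [0, N(T+3))^k`. [folklore] -/
def boxP (k : ℕ) (T : ℝ) : Finset (Fin (k + 1) → ℕ) :=
  Fintype.piFinset (Fin.cons (Finset.range (zetaZeroCount T)) (fun _ : Fin k ↦ Finset.range (zetaZeroCount (T + 3))))

/-- **The sharp sum in the `L`-normalisation**: `S'_Φ(T) = Σ_{m ∈ [0,N(T))ⁿ} f_Φ(Lγ_m/2π)`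
(Rudnick–Sarnak's `C̃_n(Φ, T)` of (3.75)). [cite: RudnickSarnak1996, (3.75)] -/
def sharpL (Φ : (Fin (k + 1) → ℝ) → ℂ) (T : ℝ) : ℂ :=
  ∑ m ∈ box k (zetaZeroCount T), fT Φ T m

/-- The weight `w(a, n) = (1 + L|γ_n − γ_a|/2π)^{-3}` of the key lemma. [folklore] -/
def w3 (T : ℝ) (a n : ℕ) : ℝ :=
  ((1 + Real.log T * |zetaOrdinate n - zetaOrdinate a| / (2 * π)) ^ 3)⁻¹

/-- The normalised distance `d(a, n) = L|γ_n − γ_a|/2π`. [folklore] -/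
def nd (T : ℝ) (a n : ℕ) : ℝ := Real.log T * |zetaOrdinate n - zetaOrdinate a| / (2 * π)

/-- `d ≥ 0` (for `log T ≥ 0`). [folklore] -/
theorem nd_nonneg {T : ℝ} (hL : 0 ≤ Real.log T) (a n : ℕ) : 0 ≤ nd T a n := by
  unfold nd; positivity

/-- `w = (1 + d)^{-3}`. [folklore] -/
theorem w3_eq (T : ℝ) (a n : ℕ) : w3 T a n = ((1 + nd T a n) ^ 3)⁻¹ := rfl

/-- `w > 0`. [folklore] -/
theorem w3_pos {T : ℝ} (hL : 0 ≤ Real.log T) (a n : ℕ) : 0 < w3 T a n := by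
  rw [w3_eq]; have := nd_nonneg hL a n; positivity

/-- `w ≤ 1`. [folklore] -/
theorem w3_le_one {T : ℝ} (hL : 0 ≤ Real.log T) (a n : ℕ) : w3 T a n ≤ 1 := by
  rw [w3_eq]; have := nd_nonneg hL a n
  exact inv_le_one_of_one_le₀ (one_le_pow₀ (by linarith))

/-- `locSum` is the sum of the weights. [folklore] -/
theorem locSum_eq (T : ℝ) (a : ℕ) : locSum T a = ∑ n ∈ Finset.range (zetaZeroCount (T + 3)), w3 T a n := rfl

/-! ## Decay of the test factor along tuples -/

/-- `f_Φ(Lγ_m/2π) = Ψ_Φ(z_m)` with `z_m = (L(γ_{m_{i+1}} − γ_{m_0})/2π)_i`. [cite: RudnickSarnak1996, (3.6)] -/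
theorem fT_eq_psiFn (Φ : (Fin (k + 1) → ℝ) → ℂ) (T : ℝ) (m : Fin (k + 1) → ℕ) :
    fT Φ T m = psiFn Φ (fun i ↦ Real.log T * (zetaOrdinate (m i.succ) - zetaOrdinate (m 0)) / (2 * π)) := by
  unfold fT
  rw [rsPhiTest_eq_psiFn]
  congr 1
  funext i
  ring

/-- **Product decay along tuples**: `‖f_Φ(Lγ_m/2π)‖ ≤ C_a Π_i (1 + d(m_0, m_{i+1}))^{-a}`.
[cite: RudnickSarnak1996, p. 303] -/
theorem exists_norm_fT_le_prod {Φ : (Fin (k + 1) → ℝ) → ℂ} (hd : ContDiff ℝ ∞ Φ) (hs : HasCompactSupport Φ) (a : ℕ) :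
    ∃ C : ℝ, 0 ≤ C ∧ ∀ T : ℝ, 0 ≤ Real.log T → ∀ m : Fin (k + 1) → ℕ,
      ‖fT Φ T m‖ ≤ C * ∏ i : Fin k, ((1 + nd T (m 0) (m i.succ)) ^ a)⁻¹ := by
  obtain ⟨C, hC0, hC⟩ := exists_norm_psiFn_le_prod hd hs a
  refine ⟨C, hC0, fun T hL m ↦ ?_⟩
  rw [fT_eq_psiFn]
  refine (hC _).trans (le_of_eq ?_)
  congr 1
  refine Finset.prod_congr rfl fun i _ ↦ ?_
  unfold nd
  rw [abs_div, abs_mul, abs_of_nonneg hL, abs_of_pos (by positivity : (0 : ℝ) < 2 * π)]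

/-- Sup bound along tuples. [folklore] -/
theorem exists_norm_fT_le {Φ : (Fin (k + 1) → ℝ) → ℂ} (hd : ContDiff ℝ ∞ Φ) (hs : HasCompactSupport Φ) :
    ∃ C : ℝ, 0 ≤ C ∧ ∀ (T : ℝ) (m : Fin (k + 1) → ℕ), ‖fT Φ T m‖ ≤ C := by
  obtain ⟨C, hC0, hC⟩ := exists_norm_psiFn_le hd hs
  exact ⟨C, hC0, fun T m ↦ by rw [fT_eq_psiFn]; exact hC _⟩

/-! ## Box sums of product weights -/

/-- `Σ_{m ∈ boxP} Π_i g(m_0, m_{i+1}) = Σ_{a < N(T)} (Σ_{n < N(T+3)} g(a, n))^k`. [folklore] -/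
theorem sum_boxP_prod (T : ℝ) (g : ℕ → ℕ → ℝ) :
    ∑ m ∈ boxP k T, ∏ i : Fin k, g (m 0) (m i.succ) =
      ∑ a ∈ Finset.range (zetaZeroCount T), (∑ n ∈ Finset.range (zetaZeroCount (T + 3)), g a n) ^ k := by
  unfold boxP
  rw [sum_piFinset_cons]
  refine Finset.sum_congr rfl fun a _ ↦ ?_
  simp only [Fin.cons_zero, Fin.cons_succ]
  rw [sum_piFinset_prod (fun _ : Fin k ↦ Finset.range (zetaZeroCount (T + 3))) (fun _ n ↦ g a n)]
  rw [Finset.prod_const, Finset.card_univ, Fintype.card_fin]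

/-- **The key lemma in box form**: `Σ_{m ∈ boxP} Π_i w(m_0, m_{i+1}) ≤ C_key T log T` for `T ≥ T₀`.
[cite: RudnickSarnak1996, Thm. 3.2 (pp. 303–304)] -/
theorem exists_sum_boxP_prod_w3_le (hRH : RiemannHypothesis) (k : ℕ) :
    ∃ C : ℝ, 0 < C ∧ ∃ T₀ : ℝ, 3 ≤ T₀ ∧ ∀ T : ℝ, T₀ ≤ T →
      ∑ m ∈ boxP k T, ∏ i : Fin k, w3 T (m 0) (m i.succ) ≤ C * T * Real.log T := by
  obtain ⟨C, hC, T₀, hT₀, h⟩ := exists_sum_locSum_pow_le hRH k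
  refine ⟨C, hC, T₀, hT₀, fun T hT ↦ ?_⟩
  rw [sum_boxP_prod T (w3 T)]
  simpa only [locSum_eq] using h T hT

/-! ## Membership bookkeeping -/

/-- Membership in `boxP`. [folklore] -/
theorem mem_boxP {T : ℝ} {m : Fin (k + 1) → ℕ} :
    m ∈ boxP k T ↔ m 0 < zetaZeroCount T ∧ ∀ i : Fin k, m i.succ < zetaZeroCount (T + 3) := by
  unfold boxP
  rw [Fintype.mem_piFinset, Fin.forall_fin_succ]
  simp

/-- Membership in `box`. [folklore] -/
theorem mem_box {N : ℕ} {m : Fin (k + 1) → ℕ} : m ∈ box k N ↔ ∀ j, m j < N := by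
  unfold box; simp [Fintype.mem_piFinset]

/-- `box N(T) ⊆ boxP`. [folklore] -/
theorem box_subset_boxP (T : ℝ) : box k (zetaZeroCount T) ⊆ boxP k T := by
  intro m hm
  rw [mem_box] at hm
  rw [mem_boxP]
  exact ⟨hm 0, fun i ↦ (hm i.succ).trans_le (zetaZeroCount_mono (by linarith))⟩

/-! ## The finite-box estimate -/

/-- The window is bounded: `0 ≤ K_T(m) ≤ K_max`. [folklore] -/
def Kmax (k : ℕ) : ℝ := ker 0 ^ k * (2 * kerC + 2 * ker 0)

/-- `0 ≤ K_T(m)`. [folklore] -/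
theorem KT_nonneg {T : ℝ} (hT : 0 ≤ T) (m : Fin (k + 1) → ℕ) : 0 ≤ KT T m := winKer_nonneg hT _

/-- `K_T(m) ≤ K_max`. [folklore] -/
theorem KT_le_Kmax {T : ℝ} (hT : 0 ≤ T) (m : Fin (k + 1) → ℕ) : KT T m ≤ Kmax k := winKer_le hT _

/-- `0 < K_max`. [folklore] -/
theorem Kmax_pos (k : ℕ) : 0 < Kmax k := by
  unfold Kmax; have := ker_zero_pos; have := kerC_spec.1; positivity

open scoped Classical in
/-- **The finite-box estimate.** For `Φ` smooth of compact support there is `A ≥ 0` (depending on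
`Φ` and `k`) such that for every `R ≥ 1`, `ρ ∈ (0, 1]` and all `T ≥ T₀` (with `log T ≥ 1`, a
unit-window bound `B ≥ 1` for the indices below `N(T+3)`, and the key-lemma bound with constant
`C_K`):

  `‖Σ_{m ∈ boxP} f(m) K_T(m) − c(R) Σ_{m ∈ box N(T)} f(m)‖ ≤`
  `A (C_K T log T) [ (1 + Lρ/2π)^{-1} + η(R, ρ) ] + A R B^{k+1}`,

`η(R, ρ) = κ(0)^k (2C_κ/R) + 2R(k+1)κ(0)^k (κ(0)/4) ρ`: the three terms are the non-clustered
tuples (decay `a = 4` and the key lemma), the clustered interior tuples (window asymptotics) and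
the clustered boundary tuples (counting). [cite: RudnickSarnak1996, Thm. 3.2 (pp. 302–303)] -/
theorem exists_finiteBox_estimate {Φ : (Fin (k + 1) → ℝ) → ℂ} (hd : ContDiff ℝ ∞ Φ) (hs : HasCompactSupport Φ) :
    ∃ A : ℝ, 0 ≤ A ∧ ∀ (T R ρ B CK : ℝ), 1 ≤ R → 0 < ρ → ρ ≤ 1 → 1 ≤ B → 3 ≤ T → 1 ≤ Real.log T → 2 * R ≤ T →
      (∀ b : ℝ, (((Finset.range (zetaZeroCount (T + 3))).filter fun n ↦
          b ≤ zetaOrdinate n ∧ zetaOrdinate n ≤ b + 1).card : ℝ) ≤ B) →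
      (∑ m ∈ boxP k T, ∏ i : Fin k, w3 T (m 0) (m i.succ) ≤ CK) → 0 ≤ CK →
        ‖(∑ m ∈ boxP k T, fT Φ T m * (KT T m : ℂ)) - (cR k R : ℂ) * ∑ m ∈ box k (zetaZeroCount T), fT Φ T m‖ ≤
          A * CK * ((1 + Real.log T * ρ / (2 * π))⁻¹ +
            (ker 0 ^ k * (2 * kerC / R) + 2 * R * ((k + 1) * ker 0 ^ k * (ker 0 / 4 * ρ)))) +
          A * R * B ^ (k + 1) := by
  obtain ⟨C₃, hC₃0, hC₃⟩ := exists_norm_fT_le_prod hd hs 3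
  obtain ⟨C₄, hC₄0, hC₄⟩ := exists_norm_fT_le_prod hd hs 4
  obtain ⟨C₀, hC₀0, hC₀⟩ := exists_norm_fT_le hd hs
  -- the constant
  set KC : ℝ := Kmax k + cLim k
  have hKC : 0 < KC := add_pos (Kmax_pos k) (cLim_pos k)
  refine ⟨max (KC * C₄ + C₃) (6 * 3 ^ k * C₀ * KC), by positivity, ?_⟩
  intro T R ρ B CK hR hρ0 hρ1 hB hT hL hRT hunit hkey hCK0
  have hT0 : (0 : ℝ) ≤ T := by linarith
  have hL0 : (0 : ℝ) ≤ Real.log T := by linarith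
  set N := zetaZeroCount T
  set N₃ := zetaZeroCount (T + 3)
  set P := boxP k T
  set Bx := box k N
  have hBxP : Bx ⊆ P := box_subset_boxP T
  -- rewrite the difference as one sum over `P`
  set Δ : (Fin (k + 1) → ℕ) → ℂ := fun m ↦ (KT T m : ℂ) - if m ∈ Bx then (cR k R : ℂ) else 0
  have hrewrite : (∑ m ∈ P, fT Φ T m * (KT T m : ℂ)) - (cR k R : ℂ) * ∑ m ∈ Bx, fT Φ T m =
      ∑ m ∈ P, fT Φ T m * Δ m := by
    have h1 : (cR k R : ℂ) * ∑ m ∈ Bx, fT Φ T m = ∑ m ∈ P, fT Φ T m * (if m ∈ Bx then (cR k R : ℂ) else 0) := by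
      rw [Finset.mul_sum, ← Finset.sum_subset hBxP (f := fun m ↦ fT Φ T m * (if m ∈ Bx then (cR k R : ℂ) else 0))]
      · refine Finset.sum_congr rfl fun m hm ↦ ?_
        rw [if_pos hm, mul_comm]
      · intro m _ hm
        rw [if_neg hm, mul_zero]
    rw [h1, ← Finset.sum_sub_distrib]
    refine Finset.sum_congr rfl fun m _ ↦ ?_
    simp only [Δ]
    ring
  rw [hrewrite]
  -- `|Δ m| ≤ KC` always
  have hcR0 : 0 ≤ cR k R := cR_nonneg k (by linarith)
  have hcRle : cR k R ≤ cLim k := cR_le_cLim k (by linarith)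
  have hΔ : ∀ m, ‖Δ m‖ ≤ KC := by
    intro m
    simp only [Δ]
    have hK := KT_le_Kmax hT0 m (k := k)
    have hK0 := KT_nonneg hT0 m (k := k)
    split_ifs
    · rw [← Complex.ofReal_sub, Complex.norm_real, Real.norm_eq_abs]
      rw [abs_le]; constructor <;> nlinarith [Kmax_pos k, cLim_pos k]
    · rw [sub_zero, Complex.norm_real, Real.norm_of_nonneg hK0]
      linarith [cLim_pos k]
  -- classification of tuples
  set clus : (Fin (k + 1) → ℕ) → Prop := fun m ↦ ∀ i : Fin k, |zetaOrdinate (m i.succ) - zetaOrdinate (m 0)| ≤ ρ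
  set intr : (Fin (k + 1) → ℕ) → Prop := fun m ↦ R ≤ zetaOrdinate (m 0) ∧ zetaOrdinate (m 0) ≤ T - R
  -- (1) non-clustered tuples: decay `a = 4` gains `(1 + Lρ/2π)^{-1}` over the key weights
  have h1 : ∀ m ∈ P, ¬ clus m → ‖fT Φ T m * Δ m‖ ≤
      KC * C₄ * (1 + Real.log T * ρ / (2 * π))⁻¹ * ∏ i : Fin k, w3 T (m 0) (m i.succ) := by
    intro m _ hnc
    simp only [clus, not_forall, not_le] at hnc
    obtain ⟨i₀, hi₀⟩ := hnc
    rw [norm_mul]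
    have hf := hC₄ T hL0 m
    -- `Π (1+d)^{-4} ≤ (1 + Lρ/2π)^{-1} Π (1+d)^{-3}`
    have hprod : ∏ i : Fin k, ((1 + nd T (m 0) (m i.succ)) ^ 4)⁻¹ ≤
        (1 + Real.log T * ρ / (2 * π))⁻¹ * ∏ i : Fin k, w3 T (m 0) (m i.succ) := by
      have hsplit : ∀ i : Fin k, ((1 + nd T (m 0) (m i.succ)) ^ 4)⁻¹ =
          (1 + nd T (m 0) (m i.succ))⁻¹ * w3 T (m 0) (m i.succ) := by
        intro i; rw [w3_eq, ← mul_inv, ← pow_succ']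
      simp_rw [hsplit]
      rw [Finset.prod_mul_distrib]
      refine mul_le_mul_of_nonneg_right ?_ (Finset.prod_nonneg fun i _ ↦ (w3_pos hL0 _ _).le)
      -- the product of the `(1+d)^{-1} ≤ 1` is at most its `i₀`-th factor
      calc ∏ i : Fin k, (1 + nd T (m 0) (m i.succ))⁻¹ ≤ (1 + nd T (m 0) (m i₀.succ))⁻¹ := by
            rw [← Finset.prod_erase_mul _ _ (Finset.mem_univ i₀)]
            refine mul_le_of_le_one_left (by have := nd_nonneg hL0 (m 0) (m i₀.succ); positivity) ?_
            exact Finset.prod_le_one (fun i _ ↦ by have := nd_nonneg hL0 (m 0) (m i.succ); positivity)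
              fun i _ ↦ inv_le_one_of_one_le₀ (by linarith [nd_nonneg hL0 (m 0) (m i.succ)])
        _ ≤ (1 + Real.log T * ρ / (2 * π))⁻¹ := by
            refine inv_anti₀ (by positivity) ?_
            unfold nd
            have : Real.log T * ρ ≤ Real.log T * |zetaOrdinate (m i₀.succ) - zetaOrdinate (m 0)| :=
              mul_le_mul_of_nonneg_left hi₀.le hL0
            have h2 : Real.log T * ρ / (2 * π) ≤ Real.log T * |zetaOrdinate (m i₀.succ) - zetaOrdinate (m 0)| / (2 * π) :=
              div_le_div_of_nonneg_right this (by positivity)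
            linarith
    calc ‖fT Φ T m‖ * ‖Δ m‖ ≤ (C₄ * ∏ i : Fin k, ((1 + nd T (m 0) (m i.succ)) ^ 4)⁻¹) * KC :=
          mul_le_mul hf (hΔ m) (norm_nonneg _) (by positivity)
      _ ≤ (C₄ * ((1 + Real.log T * ρ / (2 * π))⁻¹ * ∏ i : Fin k, w3 T (m 0) (m i.succ))) * KC :=
          mul_le_mul_of_nonneg_right (mul_le_mul_of_nonneg_left hprod hC₄0) hKC.le
      _ = KC * C₄ * (1 + Real.log T * ρ / (2 * π))⁻¹ * ∏ i : Fin k, w3 T (m 0) (m i.succ) := by ring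
  -- (2) clustered interior tuples: the window is `c(R)` up to `η`
  set η : ℝ := ker 0 ^ k * (2 * kerC / R) + 2 * R * ((k + 1) * ker 0 ^ k * (ker 0 / 4 * ρ))
  have hη0 : 0 ≤ η := by
    have := ker_zero_pos; have := kerC_spec.1
    positivity
  have h2 : ∀ m ∈ P, clus m → intr m → ‖fT Φ T m * Δ m‖ ≤ C₃ * η * ∏ i : Fin k, w3 T (m 0) (m i.succ) := by
    intro m _ hc hi
    -- such tuples lie in `Bx`
    have hmBx : m ∈ Bx := by
      rw [mem_box]
      intro j
      refine Fin.cases ?_ (fun i ↦ ?_) j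
      · exact lt_zetaZeroCount_iff.2 (by linarith [hi.2])
      · refine lt_zetaZeroCount_iff.2 ?_
        have := (abs_le.1 (hc i)).2
        linarith [hi.2]
    have hwin : |KT T m - cR k R| ≤ η := by
      refine abs_winKer_sub_cR_le (by linarith) (γ := ordTuple m) hi.1 hi.2 fun j ↦ ?_
      refine Fin.cases (by simp; linarith) (fun i ↦ ?_) j
      exact hc i
    rw [norm_mul]
    have hΔm : ‖Δ m‖ ≤ η := by
      simp only [Δ, if_pos hmBx]
      rw [← Complex.ofReal_sub, Complex.norm_real, Real.norm_eq_abs]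
      exact hwin
    calc ‖fT Φ T m‖ * ‖Δ m‖ ≤ (C₃ * ∏ i : Fin k, ((1 + nd T (m 0) (m i.succ)) ^ 3)⁻¹) * η :=
          mul_le_mul (hC₃ T hL0 m) hΔm (norm_nonneg _)
            (mul_nonneg hC₃0 (Finset.prod_nonneg fun i _ ↦ by have := nd_nonneg hL0 (m 0) (m i.succ); positivity))
      _ = C₃ * η * ∏ i : Fin k, w3 T (m 0) (m i.succ) := by simp only [w3_eq]; ring
  -- (3) clustered boundary tuples: few
  have h3 : ∀ m ∈ P, ‖fT Φ T m * Δ m‖ ≤ C₀ * KC := fun m _ ↦ by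
    rw [norm_mul]; exact mul_le_mul (hC₀ T m) (hΔ m) (norm_nonneg _) hC₀0
  -- counting the clustered boundary tuples
  have hcount : (((P.filter fun m ↦ clus m ∧ ¬ intr m).card : ℕ) : ℝ) ≤ 6 * R * B * (3 * B) ^ k := by
    -- such `m` have `m 0` in the boundary set and tails in the `ρ`-window of `γ_{m 0}`
    set bdry : Finset ℕ := (Finset.range N).filter fun a ↦ ¬ (R ≤ zetaOrdinate a ∧ zetaOrdinate a ≤ T - R)
    set tail : ℕ → Finset ℕ := fun a ↦ (Finset.range N₃).filter fun n ↦ |zetaOrdinate n - zetaOrdinate a| ≤ 1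
    have hsub : (P.filter fun m ↦ clus m ∧ ¬ intr m) ⊆
        (Fintype.piFinset (Fin.cons bdry (fun _ : Fin k ↦ Finset.range N₃) : Fin (k + 1) → Finset ℕ)).filter
          (fun m ↦ ∀ i : Fin k, m i.succ ∈ tail (m 0)) := by
      intro m hm
      rw [Finset.mem_filter] at hm
      obtain ⟨hmP, hc, hni⟩ := hm
      rw [mem_boxP] at hmP
      rw [Finset.mem_filter, Fintype.mem_piFinset, Fin.forall_fin_succ]
      simp only [Fin.cons_zero, Fin.cons_succ]
      refine ⟨⟨?_, fun i ↦ Finset.mem_range.2 (hmP.2 i)⟩, fun i ↦ ?_⟩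
      · simp only [bdry, Finset.mem_filter, Finset.mem_range]
        exact ⟨hmP.1, hni⟩
      · simp only [tail, Finset.mem_filter, Finset.mem_range]
        exact ⟨hmP.2 i, (hc i).trans hρ1⟩
    have hcard1 := Finset.card_le_card hsub
    -- count the right-hand side
    have hbdry : ((bdry.card : ℕ) : ℝ) ≤ 6 * R * B := by
      -- `bdry ⊆ {γ_a ≤ R} ∪ {T - R < γ_a ≤ T}`; both are windows of half-width `≤ R` resp. `R/2`
      have hsub2 : bdry ⊆ ((Finset.range N₃).filter fun a ↦ |zetaOrdinate a - 0| ≤ R) ∪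
          ((Finset.range N₃).filter fun a ↦ |zetaOrdinate a - T| ≤ R) := by
        intro a ha
        simp only [bdry, Finset.mem_filter, Finset.mem_range, not_and_or, not_le] at ha
        obtain ⟨haN, hab⟩ := ha
        have haN₃ : a < N₃ := haN.trans_le (zetaZeroCount_mono (by linarith))
        have haT : zetaOrdinate a ≤ T := lt_zetaZeroCount_iff.1 haN
        have ha0 : 0 < zetaOrdinate a := zetaOrdinate_pos_holds a
        rw [Finset.mem_union, Finset.mem_filter, Finset.mem_filter, Finset.mem_range]
        rcases hab with h | h
        · left; refine ⟨haN₃, ?_⟩; rw [sub_zero, abs_of_pos ha0]; exact h.le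
        · right; refine ⟨haN₃, ?_⟩; rw [abs_le]; constructor <;> linarith
      have hwinR : ∀ c : ℝ, ((((Finset.range N₃).filter fun a ↦ |zetaOrdinate a - c| ≤ R).card : ℕ) : ℝ) ≤ (2 * R + 1) * B := by
        intro c
        -- cover `[c - R, c + R]` by `⌊2R⌋ + 1` unit windows (as in `card_filter_abs_sub_le_le`)
        classical
        set J : ℕ := ⌊2 * R⌋₊ + 1
        set b0 : ℝ := c - R
        have hsub3 : ((Finset.range N₃).filter fun a ↦ |zetaOrdinate a - c| ≤ R) ⊆
            (Finset.range J).biUnion fun j ↦ (Finset.range N₃).filter fun n ↦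
              b0 + j ≤ zetaOrdinate n ∧ zetaOrdinate n ≤ b0 + j + 1 := by
          intro n hn
          rw [Finset.mem_filter] at hn
          obtain ⟨hnR, hna⟩ := hn
          rw [abs_le] at hna
          rw [Finset.mem_biUnion]
          set j : ℕ := ⌊zetaOrdinate n - b0⌋₊
          have hx0 : 0 ≤ zetaOrdinate n - b0 := by simp only [b0]; linarith
          refine ⟨j, ?_, ?_⟩
          · rw [Finset.mem_range]
            have : j ≤ ⌊2 * R⌋₊ := Nat.floor_le_floor (by simp only [b0]; linarith)
            omega
          · rw [Finset.mem_filter]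
            refine ⟨hnR, ?_, ?_⟩
            · have := Nat.floor_le hx0; linarith
            · have := Nat.lt_floor_add_one (zetaOrdinate n - b0); linarith
        calc ((((Finset.range N₃).filter fun a ↦ |zetaOrdinate a - c| ≤ R).card : ℕ) : ℝ)
            ≤ (((Finset.range J).biUnion fun j ↦ (Finset.range N₃).filter fun n ↦
                b0 + j ≤ zetaOrdinate n ∧ zetaOrdinate n ≤ b0 + j + 1).card : ℝ) := by
              exact_mod_cast Finset.card_le_card hsub3
          _ ≤ ∑ j ∈ Finset.range J, (((Finset.range N₃).filter fun n ↦
                b0 + j ≤ zetaOrdinate n ∧ zetaOrdinate n ≤ b0 + j + 1).card : ℝ) := by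
              exact_mod_cast Finset.card_biUnion_le
          _ ≤ ∑ _j ∈ Finset.range J, B := Finset.sum_le_sum fun j _ ↦ hunit _
          _ = J * B := by rw [Finset.sum_const, Finset.card_range, nsmul_eq_mul]
          _ ≤ (2 * R + 1) * B := by
              refine mul_le_mul_of_nonneg_right ?_ (by linarith)
              simp only [J]; push_cast
              linarith [Nat.floor_le (by linarith : 0 ≤ 2 * R)]
      calc ((bdry.card : ℕ) : ℝ) ≤ ((((Finset.range N₃).filter fun a ↦ |zetaOrdinate a - 0| ≤ R) ∪
            ((Finset.range N₃).filter fun a ↦ |zetaOrdinate a - T| ≤ R)).card : ℝ) := by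
            exact_mod_cast Finset.card_le_card hsub2
        _ ≤ ((((Finset.range N₃).filter fun a ↦ |zetaOrdinate a - 0| ≤ R).card : ℕ) : ℝ) +
            ((((Finset.range N₃).filter fun a ↦ |zetaOrdinate a - T| ≤ R).card : ℕ) : ℝ) := by
            exact_mod_cast Finset.card_union_le _ _
        _ ≤ (2 * R + 1) * B + (2 * R + 1) * B := add_le_add (hwinR 0) (hwinR T)
        _ ≤ 6 * R * B := by nlinarith
    have htail : ∀ a, (((tail a).card : ℕ) : ℝ) ≤ 3 * B := by
      intro a
      have h := card_filter_abs_sub_le_le (R := Finset.range N₃) (w := 1) zero_le_one hunit (by linarith) a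
      simp only [tail]
      linarith
    -- the filtered box is in bijection-free terms bounded by `Σ_{a ∈ bdry} (#tail a)^k`
    have hcard2 : ((((Fintype.piFinset (Fin.cons bdry (fun _ : Fin k ↦ Finset.range N₃) : Fin (k + 1) → Finset ℕ)).filter
        fun m ↦ ∀ i : Fin k, m i.succ ∈ tail (m 0)).card : ℕ) : ℝ) ≤ 6 * R * B * (3 * B) ^ k := by
      classical
      rw [Finset.card_filter]
      push_cast
      rw [sum_piFinset_cons]
      simp only [Fin.cons_zero, Fin.cons_succ]
      have hinner : ∀ a ∈ bdry, ∑ u ∈ Fintype.piFinset (fun _ : Fin k ↦ Finset.range N₃),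
          (if ∀ i : Fin k, u i ∈ tail a then (1 : ℝ) else 0) ≤ (3 * B) ^ k := by
        intro a _
        have : ∀ u : Fin k → ℕ, (if ∀ i : Fin k, u i ∈ tail a then (1 : ℝ) else 0) =
            ∏ i : Fin k, (if u i ∈ tail a then (1 : ℝ) else 0) := by
          intro u; rw [Finset.prod_boole]; simp
        simp_rw [this]
        rw [sum_piFinset_prod (fun _ : Fin k ↦ Finset.range N₃) (fun _ n ↦ if n ∈ tail a then (1 : ℝ) else 0)]
        rw [Finset.prod_const, Finset.card_univ, Fintype.card_fin]
        refine pow_le_pow_left₀ (Finset.sum_nonneg fun n _ ↦ by positivity) ?_ _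
        rw [Finset.sum_boole]
        have : ((Finset.range N₃).filter fun n ↦ n ∈ tail a) = tail a := by
          ext n; simp [tail]
        rw [this]
        exact htail a
      calc ∑ a ∈ bdry, ∑ u ∈ Fintype.piFinset (fun _ : Fin k ↦ Finset.range N₃),
            (if ∀ i : Fin k, u i ∈ tail a then (1 : ℝ) else 0)
          ≤ ∑ _a ∈ bdry, (3 * B) ^ k := Finset.sum_le_sum hinner
        _ = bdry.card * (3 * B) ^ k := by rw [Finset.sum_const, nsmul_eq_mul]
        _ ≤ 6 * R * B * (3 * B) ^ k := mul_le_mul_of_nonneg_right hbdry (by positivity)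
    exact le_trans (by exact_mod_cast hcard1) hcard2
  -- assemble: split the sum over `P` into the three classes
  have hsplit : ‖∑ m ∈ P, fT Φ T m * Δ m‖ ≤
      ∑ m ∈ P.filter (fun m ↦ ¬ clus m), ‖fT Φ T m * Δ m‖ +
      ∑ m ∈ P.filter (fun m ↦ clus m ∧ intr m), ‖fT Φ T m * Δ m‖ +
      ∑ m ∈ P.filter (fun m ↦ clus m ∧ ¬ intr m), ‖fT Φ T m * Δ m‖ := by
    refine (norm_sum_le _ _).trans (le_of_eq ?_)
    rw [← Finset.sum_filter_add_sum_filter_not P (fun m ↦ clus m)]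
    rw [← Finset.sum_filter_add_sum_filter_not (P.filter fun m ↦ clus m) (fun m ↦ intr m)]
    rw [Finset.filter_filter, Finset.filter_filter]
    ring
  refine hsplit.trans ?_
  -- bound each class
  have hA1 : ∑ m ∈ P.filter (fun m ↦ ¬ clus m), ‖fT Φ T m * Δ m‖ ≤
      KC * C₄ * (1 + Real.log T * ρ / (2 * π))⁻¹ * CK := by
    calc ∑ m ∈ P.filter (fun m ↦ ¬ clus m), ‖fT Φ T m * Δ m‖
        ≤ ∑ m ∈ P.filter (fun m ↦ ¬ clus m), KC * C₄ * (1 + Real.log T * ρ / (2 * π))⁻¹ * ∏ i : Fin k, w3 T (m 0) (m i.succ) :=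
          Finset.sum_le_sum fun m hm ↦ by
            rw [Finset.mem_filter] at hm; exact h1 m hm.1 hm.2
      _ ≤ ∑ m ∈ P, KC * C₄ * (1 + Real.log T * ρ / (2 * π))⁻¹ * ∏ i : Fin k, w3 T (m 0) (m i.succ) :=
          Finset.sum_le_sum_of_subset_of_nonneg (Finset.filter_subset _ _) fun m _ _ ↦ by
            have := Finset.prod_nonneg fun (i : Fin k) (_ : i ∈ (Finset.univ : Finset (Fin k))) ↦ (w3_pos hL0 (m 0) (m i.succ)).le
            exact mul_nonneg (mul_nonneg (mul_nonneg hKC.le hC₄0) (by positivity)) this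
      _ = KC * C₄ * (1 + Real.log T * ρ / (2 * π))⁻¹ * ∑ m ∈ P, ∏ i : Fin k, w3 T (m 0) (m i.succ) := by
          rw [Finset.mul_sum]
      _ ≤ KC * C₄ * (1 + Real.log T * ρ / (2 * π))⁻¹ * CK := mul_le_mul_of_nonneg_left hkey (by positivity)
  have hA2 : ∑ m ∈ P.filter (fun m ↦ clus m ∧ intr m), ‖fT Φ T m * Δ m‖ ≤ C₃ * η * CK := by
    calc ∑ m ∈ P.filter (fun m ↦ clus m ∧ intr m), ‖fT Φ T m * Δ m‖
        ≤ ∑ m ∈ P.filter (fun m ↦ clus m ∧ intr m), C₃ * η * ∏ i : Fin k, w3 T (m 0) (m i.succ) :=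
          Finset.sum_le_sum fun m hm ↦ by
            rw [Finset.mem_filter] at hm; exact h2 m hm.1 hm.2.1 hm.2.2
      _ ≤ ∑ m ∈ P, C₃ * η * ∏ i : Fin k, w3 T (m 0) (m i.succ) :=
          Finset.sum_le_sum_of_subset_of_nonneg (Finset.filter_subset _ _) fun m _ _ ↦ by
            have := Finset.prod_nonneg fun (i : Fin k) (_ : i ∈ (Finset.univ : Finset (Fin k))) ↦ (w3_pos hL0 (m 0) (m i.succ)).le
            exact mul_nonneg (mul_nonneg hC₃0 hη0) this
      _ = C₃ * η * ∑ m ∈ P, ∏ i : Fin k, w3 T (m 0) (m i.succ) := by rw [Finset.mul_sum]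
      _ ≤ C₃ * η * CK := mul_le_mul_of_nonneg_left hkey (by positivity)
  have hA3 : ∑ m ∈ P.filter (fun m ↦ clus m ∧ ¬ intr m), ‖fT Φ T m * Δ m‖ ≤ 6 * R * B * (3 * B) ^ k * (C₀ * KC) := by
    calc ∑ m ∈ P.filter (fun m ↦ clus m ∧ ¬ intr m), ‖fT Φ T m * Δ m‖
        ≤ ∑ _m ∈ P.filter (fun m ↦ clus m ∧ ¬ intr m), C₀ * KC :=
          Finset.sum_le_sum fun m hm ↦ by rw [Finset.mem_filter] at hm; exact h3 m hm.1
      _ = ((P.filter fun m ↦ clus m ∧ ¬ intr m).card : ℝ) * (C₀ * KC) := by rw [Finset.sum_const, nsmul_eq_mul]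
      _ ≤ 6 * R * B * (3 * B) ^ k * (C₀ * KC) := mul_le_mul_of_nonneg_right hcount (by positivity)
  -- compare with the claimed bound
  set Amax := max (KC * C₄ + C₃) (6 * 3 ^ k * C₀ * KC)
  have hAm1 : KC * C₄ ≤ Amax := le_trans (by linarith) (le_max_left _ _)
  have hAm2 : C₃ ≤ Amax := le_trans (by nlinarith) (le_max_left _ _)
  have hAm3 : 6 * 3 ^ k * C₀ * KC ≤ Amax := le_max_right _ _
  have hinv0 : 0 ≤ (1 + Real.log T * ρ / (2 * π))⁻¹ := by positivity
  have hBk : 6 * R * B * (3 * B) ^ k * (C₀ * KC) = (6 * 3 ^ k * C₀ * KC) * R * B ^ (k + 1) := by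
    rw [mul_pow, pow_succ]; ring
  calc ∑ m ∈ P.filter (fun m ↦ ¬ clus m), ‖fT Φ T m * Δ m‖ +
        ∑ m ∈ P.filter (fun m ↦ clus m ∧ intr m), ‖fT Φ T m * Δ m‖ +
        ∑ m ∈ P.filter (fun m ↦ clus m ∧ ¬ intr m), ‖fT Φ T m * Δ m‖
      ≤ KC * C₄ * (1 + Real.log T * ρ / (2 * π))⁻¹ * CK + C₃ * η * CK + 6 * R * B * (3 * B) ^ k * (C₀ * KC) :=
        add_le_add (add_le_add hA1 hA2) hA3
    _ ≤ Amax * (1 + Real.log T * ρ / (2 * π))⁻¹ * CK + Amax * η * CK + Amax * R * B ^ (k + 1) := by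
        rw [hBk]
        have h1' : KC * C₄ * (1 + Real.log T * ρ / (2 * π))⁻¹ * CK ≤ Amax * (1 + Real.log T * ρ / (2 * π))⁻¹ * CK :=
          mul_le_mul_of_nonneg_right (mul_le_mul_of_nonneg_right hAm1 hinv0) hCK0
        have h2' : C₃ * η * CK ≤ Amax * η * CK := mul_le_mul_of_nonneg_right (mul_le_mul_of_nonneg_right hAm2 hη0) hCK0
        have h3' : 6 * 3 ^ k * C₀ * KC * R * B ^ (k + 1) ≤ Amax * R * B ^ (k + 1) :=
          mul_le_mul_of_nonneg_right (mul_le_mul_of_nonneg_right hAm3 (by linarith)) (by positivity)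
        linarith
    _ = Amax * CK * ((1 + Real.log T * ρ / (2 * π))⁻¹ + η) + Amax * R * B ^ (k + 1) := by ring

/-! ## The zeros outside the working box -/

/-- A box with one slot restricted. [folklore] -/
def slotBox (k N₁ : ℕ) (j₀ : Fin (k + 1)) (S : Finset ℕ) : Finset (Fin (k + 1) → ℕ) :=
  Fintype.piFinset (Function.update (fun _ : Fin (k + 1) ↦ Finset.range N₁) j₀ S)

/-- **Window sums over a box with one far slot**: if every index in the slot `j₀` has ordinate
`≥ T' ≥ T`, then `Σ_{m} K_T(m) ≤ 2 A log(|T'| + 2) (C_D log(T + 2))^k`, where `C_D` bounds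
`Σ_n κ(t − γ_n) ≤ C_D log(|t| + 2)`. [folklore] -/
theorem sum_slotBox_KT_le {A CD : ℝ} (hA : ∀ (t T' : ℝ), t ≤ T' → ∀ S : Finset ℕ, (∀ n ∈ S, T' ≤ zetaOrdinate n) →
      ∑ n ∈ S, ker (t - zetaOrdinate n) ≤ A * Real.log (|T'| + 2) / (1 + (T' - t) ^ 2))
    (hCD : 0 ≤ CD) (hD : ∀ t : ℝ, ∑' n : ℕ, ker (t - zetaOrdinate n) ≤ CD * Real.log (|t| + 2))
    {T T' : ℝ} (hT : 0 ≤ T) (hTT' : T ≤ T') (N₁ : ℕ) (j₀ : Fin (k + 1)) {S : Finset ℕ}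
    (hS : ∀ n ∈ S, T' ≤ zetaOrdinate n) :
    ∑ m ∈ slotBox k N₁ j₀ S, KT T m ≤ 2 * (A * Real.log (|T'| + 2)) * (CD * Real.log (T + 2)) ^ k := by
  have hA0 : 0 ≤ A * Real.log (|T'| + 2) := by
    have h := hA T' T' le_rfl ∅ (by simp)
    simp only [Finset.sum_empty, sub_self] at h
    have : A * Real.log (|T'| + 2) / (1 + 0 ^ 2) = A * Real.log (|T'| + 2) := by norm_num
    linarith [this ▸ h]
  -- swap the finite sum and the `t`-integral
  have hcont : ∀ m : Fin (k + 1) → ℕ, Continuous fun t : ℝ ↦ ∏ j, ker (t - zetaOrdinate (m j)) :=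
    fun m ↦ continuous_prod_ker (ordTuple m)
  have hswap : ∑ m ∈ slotBox k N₁ j₀ S, KT T m =
      ∫ t in (0 : ℝ)..T, ∑ m ∈ slotBox k N₁ j₀ S, ∏ j, ker (t - zetaOrdinate (m j)) := by
    rw [intervalIntegral.integral_finsetSum fun m _ ↦ (hcont m).intervalIntegrable _ _]
    rfl
  rw [hswap]
  -- pointwise bound of the integrand
  have hpt : ∀ t ∈ Set.Icc (0 : ℝ) T, ∑ m ∈ slotBox k N₁ j₀ S, ∏ j, ker (t - zetaOrdinate (m j)) ≤
      (A * Real.log (|T'| + 2)) * (CD * Real.log (T + 2)) ^ k * (1 + (T' - t) ^ 2)⁻¹ := by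
    intro t ht
    unfold slotBox
    rw [← Finset.prod_univ_sum (Function.update (fun _ : Fin (k + 1) ↦ Finset.range N₁) j₀ S)
      (fun _ n ↦ ker (t - zetaOrdinate n))]
    -- bound factor by factor
    set g : Fin (k + 1) → ℝ := Function.update (fun _ ↦ CD * Real.log (T + 2)) j₀ (A * Real.log (|T'| + 2) / (1 + (T' - t) ^ 2))
    have hfac : ∀ j, ∑ n ∈ Function.update (fun _ : Fin (k + 1) ↦ Finset.range N₁) j₀ S j, ker (t - zetaOrdinate n) ≤ g j := by
      intro j
      by_cases hj : j = j₀
      · subst hj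
        simp only [g, Function.update_self]
        exact hA t T' (ht.2.trans hTT') S hS
      · simp only [g, Function.update_of_ne hj]
        calc ∑ n ∈ Finset.range N₁, ker (t - zetaOrdinate n) ≤ ∑' n : ℕ, ker (t - zetaOrdinate n) :=
              (summable_ker_sub t).sum_le_tsum _ fun n _ ↦ ker_nonneg _
          _ ≤ CD * Real.log (|t| + 2) := hD t
          _ ≤ CD * Real.log (T + 2) := by
              refine mul_le_mul_of_nonneg_left (Real.log_le_log (by positivity) ?_) hCD
              rw [abs_of_nonneg ht.1]; linarith [ht.2]
    calc ∏ j, ∑ n ∈ Function.update (fun _ : Fin (k + 1) ↦ Finset.range N₁) j₀ S j, ker (t - zetaOrdinate n)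
        ≤ ∏ j, g j := Finset.prod_le_prod (fun j _ ↦ Finset.sum_nonneg fun n _ ↦ ker_nonneg _) fun j _ ↦ hfac j
      _ = (A * Real.log (|T'| + 2) / (1 + (T' - t) ^ 2)) * ∏ j ∈ Finset.univ.erase j₀, g j := by
          rw [← Finset.mul_prod_erase _ _ (Finset.mem_univ j₀)]
          simp only [g, Function.update_self]
      _ = (A * Real.log (|T'| + 2) / (1 + (T' - t) ^ 2)) * (CD * Real.log (T + 2)) ^ k := by
          congr 1
          have hg : ∀ j ∈ Finset.univ.erase j₀, g j = CD * Real.log (T + 2) := fun j hj ↦ by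
            rw [Finset.mem_erase] at hj
            simp only [g, Function.update_of_ne hj.1]
          rw [Finset.prod_congr rfl hg, Finset.prod_const, Finset.card_erase_of_mem (Finset.mem_univ _),
            Finset.card_univ, Fintype.card_fin, Nat.add_sub_cancel]
      _ = (A * Real.log (|T'| + 2)) * (CD * Real.log (T + 2)) ^ k * (1 + (T' - t) ^ 2)⁻¹ := by ring
  -- integrate
  have hL2 : 0 ≤ Real.log (T + 2) := Real.log_nonneg (by linarith)
  have hconst : 0 ≤ (A * Real.log (|T'| + 2)) * (CD * Real.log (T + 2)) ^ k := by positivity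
  have hii : IntervalIntegrable (fun t : ℝ ↦ (1 + (T' - t) ^ 2)⁻¹) volume 0 T := by
    refine (Continuous.inv₀ (by fun_prop) fun t ↦ ?_).intervalIntegrable _ _
    positivity
  calc ∫ t in (0 : ℝ)..T, ∑ m ∈ slotBox k N₁ j₀ S, ∏ j, ker (t - zetaOrdinate (m j))
      ≤ ∫ t in (0 : ℝ)..T, (A * Real.log (|T'| + 2)) * (CD * Real.log (T + 2)) ^ k * (1 + (T' - t) ^ 2)⁻¹ :=
        intervalIntegral.integral_mono_on hT
          ((continuous_finsetSum _ fun m _ ↦ hcont m).intervalIntegrable _ _) (hii.const_mul _) hpt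
    _ = (A * Real.log (|T'| + 2)) * (CD * Real.log (T + 2)) ^ k * ∫ t in (0 : ℝ)..T, (1 + (T' - t) ^ 2)⁻¹ :=
        intervalIntegral.integral_const_mul _ _
    _ ≤ (A * Real.log (|T'| + 2)) * (CD * Real.log (T + 2)) ^ k * 2 := by
        refine mul_le_mul_of_nonneg_left ?_ hconst
        have hsub := intervalIntegral.integral_comp_sub_left (fun s : ℝ ↦ (1 + s ^ 2)⁻¹) T' (a := 0) (b := T)
        rw [hsub, sub_zero, integral_inv_one_add_sq]
        have h1 := Real.arctan_lt_pi_div_two T'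
        have h2 : 0 ≤ Real.arctan (T' - T) := Real.arctan_nonneg.2 (by linarith)
        linarith [Real.pi_lt_d2]
    _ = 2 * (A * Real.log (|T'| + 2)) * (CD * Real.log (T + 2)) ^ k := by ring

/-- Indices beyond `N(T')` have ordinates `≥ T'`. [cite: Titchmarsh1986, §9.1] -/
theorem le_zetaOrdinate_of_le {T' : ℝ} {n : ℕ} (h : zetaZeroCount T' ≤ n) : T' ≤ zetaOrdinate n := by
  by_contra hlt
  have := lt_zetaZeroCount_iff.2 (not_le.1 hlt).le
  omega

/-- **The zeros outside the working box**: for every `N₁`,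
`Σ_{m ∈ box N₁ ∖ boxP} ‖f(m)‖ K_T(m) ≤ C₀ (k+1) · 2 A log(T + 5) (C_D log(T+2))^k`. [folklore] -/
theorem sum_box_sdiff_boxP_le {Φ : (Fin (k + 1) → ℝ) → ℂ} {C₀ : ℝ} (hC₀0 : 0 ≤ C₀) (hC₀ : ∀ (T : ℝ) m, ‖fT Φ T m‖ ≤ C₀)
    {A CD : ℝ} (hA : ∀ (t T' : ℝ), t ≤ T' → ∀ S : Finset ℕ, (∀ n ∈ S, T' ≤ zetaOrdinate n) →
      ∑ n ∈ S, ker (t - zetaOrdinate n) ≤ A * Real.log (|T'| + 2) / (1 + (T' - t) ^ 2))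
    (hCD : 0 ≤ CD) (hD : ∀ t : ℝ, ∑' n : ℕ, ker (t - zetaOrdinate n) ≤ CD * Real.log (|t| + 2))
    {T : ℝ} (hT : 0 ≤ T) (N₁ : ℕ) :
    ∑ m ∈ box k N₁ \ boxP k T, ‖fT Φ T m * (KT T m : ℂ)‖ ≤
      C₀ * ((k + 1) * (2 * (A * Real.log (|T + 3| + 2)) * (CD * Real.log (T + 2)) ^ k)) := by
  classical
  set N := zetaZeroCount T
  set N₃ := zetaZeroCount (T + 3)
  have hNN₃ : N ≤ N₃ := zetaZeroCount_mono (by linarith)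
  -- the bad slots
  set Sbad : Fin (k + 1) → Finset ℕ := fun j ↦ Fin.cases (Finset.Ico N N₁) (fun _ ↦ Finset.Ico N₃ N₁) j
  set Tj : Fin (k + 1) → ℝ := fun j ↦ Fin.cases T (fun _ ↦ T + 3) j
  have hSbad : ∀ j, ∀ n ∈ Sbad j, Tj j ≤ zetaOrdinate n := by
    intro j
    refine Fin.cases ?_ (fun i ↦ ?_) j
    · intro n hn; simp only [Sbad, Fin.cases_zero, Finset.mem_Ico] at hn
      exact le_zetaOrdinate_of_le hn.1
    · intro n hn; simp only [Sbad, Fin.cases_succ, Finset.mem_Ico] at hn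
      exact le_zetaOrdinate_of_le hn.1
  have hTj : ∀ j, T ≤ Tj j ∧ Tj j ≤ T + 3 := fun j ↦ Fin.cases (by simp [Tj]) (fun i ↦ by simp [Tj]) j
  -- every `m` of the difference lies in some `slotBox j (Sbad j)`
  have hcover : ∀ m ∈ box k N₁ \ boxP k T, ∃ j, m ∈ slotBox k N₁ j (Sbad j) := by
    intro m hm
    rw [Finset.mem_sdiff, mem_box, mem_boxP] at hm
    obtain ⟨hmbox, hnot⟩ := hm
    rw [not_and_or, not_lt, not_forall] at hnot
    have hmem : ∀ j (S : Finset ℕ), m j ∈ S → m ∈ slotBox k N₁ j S := by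
      intro j S hj
      unfold slotBox
      rw [Fintype.mem_piFinset]
      intro j'
      by_cases h : j' = j
      · subst h; rw [Function.update_self]; exact hj
      · rw [Function.update_of_ne h]; exact Finset.mem_range.2 (hmbox j')
    rcases hnot with h0 | ⟨i, hi⟩
    · exact ⟨0, hmem 0 _ (by simp only [Sbad, Fin.cases_zero, Finset.mem_Ico]; exact ⟨h0, hmbox 0⟩)⟩
    · refine ⟨i.succ, hmem i.succ _ ?_⟩
      simp only [Sbad, Fin.cases_succ, Finset.mem_Ico]
      exact ⟨not_lt.1 hi, hmbox i.succ⟩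
  -- bound by the sum over slots
  have hKT0 : ∀ m, 0 ≤ KT T m := fun m ↦ KT_nonneg hT m (k := k)
  have hstep1 : ∑ m ∈ box k N₁ \ boxP k T, ‖fT Φ T m * (KT T m : ℂ)‖ ≤ C₀ * ∑ m ∈ box k N₁ \ boxP k T, KT T m := by
    rw [Finset.mul_sum]
    refine Finset.sum_le_sum fun m _ ↦ ?_
    rw [norm_mul, Complex.norm_real, Real.norm_of_nonneg (hKT0 m)]
    exact mul_le_mul_of_nonneg_right (hC₀ T m) (hKT0 m)
  have hstep2 : ∑ m ∈ box k N₁ \ boxP k T, KT T m ≤ ∑ j : Fin (k + 1), ∑ m ∈ slotBox k N₁ j (Sbad j), KT T m := by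
    calc ∑ m ∈ box k N₁ \ boxP k T, KT T m
        ≤ ∑ m ∈ box k N₁ \ boxP k T, ∑ j : Fin (k + 1), (if m ∈ slotBox k N₁ j (Sbad j) then KT T m else 0) := by
          refine Finset.sum_le_sum fun m hm ↦ ?_
          obtain ⟨j, hj⟩ := hcover m hm
          calc KT T m = (if m ∈ slotBox k N₁ j (Sbad j) then KT T m else 0) := by rw [if_pos hj]
            _ ≤ ∑ j' : Fin (k + 1), (if m ∈ slotBox k N₁ j' (Sbad j') then KT T m else 0) :=
                Finset.single_le_sum (f := fun j' ↦ if m ∈ slotBox k N₁ j' (Sbad j') then KT T m else 0)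
                  (fun j' _ ↦ by split_ifs <;> [exact hKT0 m; exact le_rfl]) (Finset.mem_univ j)
      _ = ∑ j : Fin (k + 1), ∑ m ∈ box k N₁ \ boxP k T, (if m ∈ slotBox k N₁ j (Sbad j) then KT T m else 0) :=
          Finset.sum_comm
      _ ≤ ∑ j : Fin (k + 1), ∑ m ∈ slotBox k N₁ j (Sbad j), KT T m := by
          refine Finset.sum_le_sum fun j _ ↦ ?_
          rw [← Finset.sum_filter]
          refine Finset.sum_le_sum_of_subset_of_nonneg (fun m hm ↦ (Finset.mem_filter.1 hm).2) fun m _ _ ↦ hKT0 m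
  have hstep3 : ∀ j, ∑ m ∈ slotBox k N₁ j (Sbad j), KT T m ≤ 2 * (A * Real.log (|T + 3| + 2)) * (CD * Real.log (T + 2)) ^ k := by
    intro j
    have h := sum_slotBox_KT_le (k := k) hA hCD hD hT (hTj j).1 N₁ j (hSbad j)
    refine h.trans ?_
    have hlog : Real.log (|Tj j| + 2) ≤ Real.log (|T + 3| + 2) := by
      refine Real.log_le_log (by positivity) ?_
      rw [abs_of_nonneg (by linarith [(hTj j).1]), abs_of_nonneg (by linarith)]
      linarith [(hTj j).2]
    have hA0 : 0 ≤ A := by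
      have h' := hA (T + 4) (T + 4) le_rfl ∅ (by simp)
      simp only [Finset.sum_empty, sub_self] at h'
      have hl : 0 < Real.log (|T + 4| + 2) := Real.log_pos (by rw [abs_of_nonneg (by linarith)]; linarith)
      have : A * Real.log (|T + 4| + 2) / (1 + 0 ^ 2) = A * Real.log (|T + 4| + 2) := by norm_num
      rw [this] at h'
      nlinarith
    have hL2 : 0 ≤ Real.log (T + 2) := Real.log_nonneg (by linarith)
    have : 0 ≤ (CD * Real.log (T + 2)) ^ k := by positivity
    gcongr
  calc ∑ m ∈ box k N₁ \ boxP k T, ‖fT Φ T m * (KT T m : ℂ)‖ ≤ C₀ * ∑ m ∈ box k N₁ \ boxP k T, KT T m := hstep1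
    _ ≤ C₀ * ∑ j : Fin (k + 1), ∑ m ∈ slotBox k N₁ j (Sbad j), KT T m := mul_le_mul_of_nonneg_left hstep2 hC₀0
    _ ≤ C₀ * ∑ _j : Fin (k + 1), 2 * (A * Real.log (|T + 3| + 2)) * (CD * Real.log (T + 2)) ^ k :=
        mul_le_mul_of_nonneg_left (Finset.sum_le_sum fun j _ ↦ hstep3 j) hC₀0
    _ = C₀ * ((k + 1) * (2 * (A * Real.log (|T + 3| + 2)) * (CD * Real.log (T + 2)) ^ k)) := by
        rw [Finset.sum_const, Finset.card_univ, Fintype.card_fin, nsmul_eq_mul]; push_cast; ring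

/-- **Truncation of the windowed sum to the working box**: for `T ≥ 0`,
`‖W_Φ(T) − Σ_{m ∈ boxP} f(m) K_T(m)‖ ≤ C₀ (k+1) 2A log(T+5) (C_D log(T+2))^k`. [folklore] -/
theorem norm_zeroSideSum_sub_sum_boxP_le {Φ : (Fin (k + 1) → ℝ) → ℂ} (hΦi : Integrable fun η : Fin k → ℝ ↦ Φ (slicePt η))
    {C₀ : ℝ} (hC₀0 : 0 ≤ C₀) (hC₀ : ∀ (T : ℝ) m, ‖fT Φ T m‖ ≤ C₀)
    {A CD : ℝ} (hA : ∀ (t T' : ℝ), t ≤ T' → ∀ S : Finset ℕ, (∀ n ∈ S, T' ≤ zetaOrdinate n) →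
      ∑ n ∈ S, ker (t - zetaOrdinate n) ≤ A * Real.log (|T'| + 2) / (1 + (T' - t) ^ 2))
    (hCD : 0 ≤ CD) (hD : ∀ t : ℝ, ∑' n : ℕ, ker (t - zetaOrdinate n) ≤ CD * Real.log (|t| + 2))
    {T : ℝ} (hT : 0 ≤ T) :
    ‖zeroSideSum Φ T - ∑ m ∈ boxP k T, fT Φ T m * (KT T m : ℂ)‖ ≤
      C₀ * ((k + 1) * (2 * (A * Real.log (|T + 3| + 2)) * (CD * Real.log (T + 2)) ^ k)) := by
  set E := C₀ * ((k + 1) * (2 * (A * Real.log (|T + 3| + 2)) * (CD * Real.log (T + 2)) ^ k))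
  -- partial sums along boxes converge to `W`
  have hbox : Tendsto (fun N₁ ↦ box k N₁) atTop atTop := by
    refine tendsto_atTop_finset_of_monotone (fun a b hab ↦ Fintype.piFinset_subset _ _ fun _ ↦ Finset.range_subset_range.2 hab)
      fun m ↦ ⟨Finset.univ.sup m + 1, ?_⟩
    rw [mem_box]
    intro j
    exact Nat.lt_succ_of_le (Finset.le_sup (f := m) (Finset.mem_univ j))
  have hsum : Summable fun m : Fin (k + 1) → ℕ ↦ fT Φ T m * (KT T m : ℂ) := summable_zeroSideSum_term hΦi hT
  have hlim : Tendsto (fun N₁ ↦ ∑ m ∈ box k N₁, fT Φ T m * (KT T m : ℂ)) atTop (𝓝 (zeroSideSum Φ T)) :=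
    hsum.hasSum.comp hbox
  have hlim2 : Tendsto (fun N₁ ↦ ‖(∑ m ∈ box k N₁, fT Φ T m * (KT T m : ℂ)) - ∑ m ∈ boxP k T, fT Φ T m * (KT T m : ℂ)‖)
      atTop (𝓝 ‖zeroSideSum Φ T - ∑ m ∈ boxP k T, fT Φ T m * (KT T m : ℂ)‖) :=
    (hlim.sub_const _).norm
  refine le_of_tendsto hlim2 ?_
  filter_upwards [eventually_ge_atTop (zetaZeroCount (T + 3))] with N₁ hN₁
  -- `boxP ⊆ box N₁`
  have hsub : boxP k T ⊆ box k N₁ := by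
    intro m hm
    rw [mem_boxP] at hm; rw [mem_box]
    intro j
    refine Fin.cases ?_ (fun i ↦ ?_) j
    · exact hm.1.trans_le ((zetaZeroCount_mono (by linarith)).trans hN₁)
    · exact (hm.2 i).trans_le hN₁
  rw [← Finset.sum_sdiff hsub, add_sub_cancel_right]
  exact (norm_sum_le _ _).trans (sum_box_sdiff_boxP_le hC₀0 hC₀ hA hCD hD hT N₁)

/-! ## Assembly: `W_Φ(T) = c S'_Φ(T) + o(T log T)` -/

/-- `log^j T ≤ ε T` eventually. [folklore] -/
theorem eventually_log_pow_le (j : ℕ) {ε : ℝ} (hε : 0 < ε) : ∀ᶠ T : ℝ in atTop, Real.log T ^ j ≤ ε * T := by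
  have h := Real.tendsto_pow_log_div_mul_add_atTop 1 0 j one_ne_zero
  have h2 := (tendsto_order.1 h).2 ε hε
  filter_upwards [h2, eventually_gt_atTop (0 : ℝ)] with T hT hT0
  rw [one_mul, add_zero, div_lt_iff₀ hT0] at hT
  exact hT.le

set_option maxHeartbeats 800000 in
/-- **Unsmoothing** (Rudnick–Sarnak 1996, Thm. 3.2, first step, pp. 302–303, in the `t`-windowed
form; RH): for `Φ` smooth of compact support and every `ε > 0` there is `T₀` such that for all
`T ≥ T₀`, `‖W_Φ(T) − c · S'_Φ(T)‖ ≤ ε T log T`, where `W_Φ = RudnickSarnakN.zeroSideSum Φ`,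
`S'_Φ(T) = Σ_{m ∈ [0,N(T))ⁿ} f_Φ(Lγ_m/2π)` and `c = ∫ κⁿ`. [cite: RudnickSarnak1996, Thm. 3.2 (pp. 302–303)] -/
theorem exists_norm_zeroSideSum_sub_le (hRH : RiemannHypothesis) {Φ : (Fin (k + 1) → ℝ) → ℂ}
    (hd : ContDiff ℝ ∞ Φ) (hs : HasCompactSupport Φ) {ε : ℝ} (hε : 0 < ε) :
    ∃ T₀ : ℝ, ∀ T : ℝ, T₀ ≤ T →
      ‖zeroSideSum Φ T - (cLim k : ℂ) * sharpL Φ T‖ ≤ ε * T * Real.log T := by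
  -- the data
  have hΦi : Integrable fun η : Fin k → ℝ ↦ Φ (slicePt η) :=
    (contDiff_sliceFn hd).continuous.integrable_of_hasCompactSupport (hasCompactSupport_sliceFn hs)
  obtain ⟨A, hA0, hfin⟩ := exists_finiteBox_estimate hd hs (k := k)
  obtain ⟨CK, hCK, TK, hTK3, hkey⟩ := exists_sum_boxP_prod_w3_le hRH k
  obtain ⟨C₁, hC₁, T₁, hunit⟩ := exists_unitWindow_le
  obtain ⟨C₃, hC₃0, hC₃⟩ := exists_norm_fT_le_prod hd hs 3
  obtain ⟨C₀, hC₀0, hC₀⟩ := exists_norm_fT_le hd hs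
  obtain ⟨Af, hAf, hfar⟩ := exists_sum_ker_far_le
  obtain ⟨CD, hCD, hD⟩ := exists_tsum_ker_sub_le
  have hκ := ker_zero_pos
  have hCκ := kerC_spec.1
  -- Step 1: the radius `R` (window tails and `c(R) → c`)
  set e₁ : ℝ := ε / 8 / (A * CK + 1)
  have he₁ : 0 < e₁ := by positivity
  set e₂ : ℝ := ε / 8 / (C₃ * CK + 1)
  have he₂ : 0 < e₂ := by positivity
  have hR_ev : ∀ᶠ R : ℝ in atTop, ker 0 ^ k * (2 * kerC / R) ≤ e₁ ∧ |cR k R - cLim k| ≤ e₂ ∧ 1 ≤ R := by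
    refine (?_ : ∀ᶠ R : ℝ in atTop, ker 0 ^ k * (2 * kerC / R) ≤ e₁).and ((?_ : ∀ᶠ R : ℝ in atTop, |cR k R - cLim k| ≤ e₂).and (eventually_ge_atTop 1))
    · have ht : Tendsto (fun R : ℝ ↦ ker 0 ^ k * (2 * kerC / R)) atTop (𝓝 0) := by
        have := (tendsto_const_nhds (x := ker 0 ^ k * (2 * kerC))).div_atTop tendsto_id
        refine this.congr' (Eventually.of_forall fun R ↦ ?_)
        simp only [id]; ring
      exact (tendsto_order.1 ht).2 e₁ he₁ |>.mono fun R h ↦ h.le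
    · have ht := tendsto_cR k
      rw [Metric.tendsto_atTop] at ht
      obtain ⟨R₀, hR₀⟩ := ht e₂ he₂
      filter_upwards [eventually_ge_atTop R₀] with R hR
      have := hR₀ R hR
      rw [Real.dist_eq] at this
      exact this.le
  obtain ⟨R, hRtail, hRc, hR1⟩ := hR_ev.exists
  -- Step 2: the cluster scale `ρ`
  set q : ℝ := A * CK * (2 * R * ((k + 1) * ker 0 ^ k * (ker 0 / 4))) + 1
  have hq : 0 < q := by positivity
  set ρ : ℝ := min 1 (ε / 8 / q)
  have hρ0 : 0 < ρ := lt_min one_pos (by positivity)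
  have hρ1 : ρ ≤ 1 := min_le_left _ _
  have hρq : ρ * q ≤ ε / 8 := by
    have : ρ ≤ ε / 8 / q := min_le_right _ _
    rwa [le_div_iff₀ hq] at this
  -- Step 3: the height `T₀`
  have hT_ev : ∀ᶠ T : ℝ in atTop,
      A * CK * (1 + Real.log T * ρ / (2 * π))⁻¹ ≤ ε / 8 ∧
      A * R * (C₁ * Real.log T) ^ (k + 1) ≤ ε / 8 * T * Real.log T ∧
      C₀ * ((k + 1) * (2 * (Af * Real.log (|T + 3| + 2)) * (CD * Real.log (T + 2)) ^ k)) ≤ ε / 8 * T * Real.log T ∧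
      A * R ≤ ε / 8 * T * Real.log T := by
    refine (?_ : ∀ᶠ T : ℝ in atTop, _).and ((?_ : ∀ᶠ T : ℝ in atTop, _).and ((?_ : ∀ᶠ T : ℝ in atTop, _).and ?_))
    rotate_right
    · -- `A R ≤ ε/8 T log T` since `T log T ≥ T → ∞`
      filter_upwards [eventually_ge_atTop (Real.exp 1), eventually_ge_atTop (A * R / (ε / 8))] with T hTe hTA
      have hT0 : 0 < T := lt_of_lt_of_le (Real.exp_pos 1) hTe
      have hL1 : 1 ≤ Real.log T := by rw [Real.le_log_iff_exp_le hT0]; exact hTe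
      rw [div_le_iff₀ (by positivity)] at hTA
      calc A * R ≤ ε / 8 * T := by linarith
        _ = ε / 8 * T * 1 := by ring
        _ ≤ ε / 8 * T * Real.log T := mul_le_mul_of_nonneg_left hL1 (by positivity)
    · -- `(1 + Lρ/2π)^{-1} → 0`
      have ht : Tendsto (fun T : ℝ ↦ A * CK * (1 + Real.log T * ρ / (2 * π))⁻¹) atTop (𝓝 0) := by
        have h1 : Tendsto (fun T : ℝ ↦ 1 + Real.log T * ρ / (2 * π)) atTop atTop := by
          refine tendsto_atTop_add_const_left _ 1 ?_
          refine Tendsto.atTop_div_const (by positivity) (Real.tendsto_log_atTop.atTop_mul_const hρ0)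
        have := h1.inv_tendsto_atTop.const_mul (A * CK)
        rwa [mul_zero] at this
      exact (tendsto_order.1 ht).2 _ (by positivity) |>.mono fun T h ↦ h.le
    · -- `L^{k+1} ≤ (ε/8AR C₁^{k+1}) T L`
      have hc : 0 < A * R * C₁ ^ (k + 1) + 1 := by positivity
      filter_upwards [eventually_log_pow_le k (ε := ε / 8 / (A * R * C₁ ^ (k + 1) + 1)) (by positivity),
        eventually_ge_atTop (1 : ℝ)] with T hT hT1
      have hL : 0 ≤ Real.log T := Real.log_nonneg hT1
      rw [mul_pow, pow_succ]
      have h2 : A * R * C₁ ^ (k + 1) ≤ A * R * C₁ ^ (k + 1) + 1 := by linarith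
      calc A * R * (C₁ ^ (k + 1) * (Real.log T ^ k * Real.log T))
          = (A * R * C₁ ^ (k + 1)) * Real.log T ^ k * Real.log T := by ring
        _ ≤ (A * R * C₁ ^ (k + 1) + 1) * (ε / 8 / (A * R * C₁ ^ (k + 1) + 1) * T) * Real.log T := by
            refine mul_le_mul_of_nonneg_right (mul_le_mul h2 hT (by positivity) hc.le) hL
        _ = ε / 8 * T * Real.log T := by field_simp
    · -- the truncation error is `O(L^{k+1})`
      filter_upwards [eventually_log_pow_le k (ε := ε / 8 / (C₀ * ((k + 1) * (2 * (Af * 2) * (CD * 2) ^ k)) + 1)) (by positivity),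
        eventually_ge_atTop (3 : ℝ)] with T hT hT3
      have hL1 : 1 ≤ Real.log T := by
        rw [Real.le_log_iff_exp_le (by linarith)]
        exact le_trans (le_of_lt (lt_trans Real.exp_one_lt_d9 (by norm_num))) hT3
      have hL0 : 0 ≤ Real.log T := by linarith
      -- `log(T+5) ≤ 2 log T`, `log(T+2) ≤ 2 log T`
      have hlogA : Real.log (|T + 3| + 2) ≤ 2 * Real.log T := by
        rw [abs_of_nonneg (by linarith)]
        have h1 : Real.log (T + 3 + 2) ≤ Real.log (T * T) := Real.log_le_log (by linarith) (by nlinarith)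
        rw [Real.log_mul (by linarith) (by linarith)] at h1; linarith
      have hlogB : Real.log (T + 2) ≤ 2 * Real.log T := by
        have h1 : Real.log (T + 2) ≤ Real.log (T * T) := Real.log_le_log (by linarith) (by nlinarith)
        rw [Real.log_mul (by linarith) (by linarith)] at h1; linarith
      set c₀ : ℝ := C₀ * ((k + 1) * (2 * (Af * 2) * (CD * 2) ^ k))
      have hc₀ : 0 ≤ c₀ := by positivity
      have hL2 : 0 ≤ Real.log (T + 2) := Real.log_nonneg (by linarith)
      calc C₀ * ((k + 1) * (2 * (Af * Real.log (|T + 3| + 2)) * (CD * Real.log (T + 2)) ^ k))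
          ≤ C₀ * ((k + 1) * (2 * (Af * (2 * Real.log T)) * (CD * (2 * Real.log T)) ^ k)) := by
            refine mul_le_mul_of_nonneg_left (mul_le_mul_of_nonneg_left ?_ (by positivity)) hC₀0
            refine mul_le_mul (mul_le_mul_of_nonneg_left (mul_le_mul_of_nonneg_left hlogA hAf.le) (by norm_num))
              (pow_le_pow_left₀ (by positivity) (mul_le_mul_of_nonneg_left hlogB hCD) _) (by positivity) (by positivity)
        _ = c₀ * (Real.log T ^ k * Real.log T) := by simp only [c₀]; rw [mul_pow, mul_pow]; ring
        _ ≤ (c₀ + 1) * (ε / 8 / (c₀ + 1) * T) * Real.log T := by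
            rw [← mul_assoc]
            refine mul_le_mul_of_nonneg_right (mul_le_mul (by linarith) hT (by positivity) (by positivity)) hL0
        _ = ε / 8 * T * Real.log T := by field_simp
  obtain ⟨T₂, hT₂⟩ := eventually_atTop.1 hT_ev
  refine ⟨max (max (max TK T₁) (max 3 (2 * R))) (max T₂ (Real.exp 1)), fun T hT ↦ ?_⟩
  have hTK : TK ≤ T := le_trans (le_trans (le_trans (le_max_left _ _) (le_max_left _ _)) (le_max_left _ _)) hT
  have hT1' : T₁ ≤ T := le_trans (le_trans (le_trans (le_max_right _ _) (le_max_left _ _)) (le_max_left _ _)) hT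
  have hT3 : (3 : ℝ) ≤ T := le_trans (le_trans (le_trans (le_max_left _ _) (le_max_right _ _)) (le_max_left _ _)) hT
  have hRT : 2 * R ≤ T := le_trans (le_trans (le_trans (le_max_right _ _) (le_max_right _ _)) (le_max_left _ _)) hT
  have hT2' : T₂ ≤ T := le_trans (le_trans (le_max_left _ _) (le_max_right _ _)) hT
  have hTe : Real.exp 1 ≤ T := le_trans (le_trans (le_max_right _ _) (le_max_right _ _)) hT
  have hT0 : (0 : ℝ) ≤ T := by linarith
  have hL1 : 1 ≤ Real.log T := by rw [Real.le_log_iff_exp_le (by linarith)]; exact hTe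
  have hL0 : 0 ≤ Real.log T := by linarith
  obtain ⟨hE1, hE2, hE3, hE4⟩ := hT₂ T hT2'
  -- the three estimates
  set B : ℝ := C₁ * Real.log T
  set B' : ℝ := max B 1
  have hB' : 1 ≤ B' := le_max_right _ _
  have hunit' : ∀ b : ℝ, (((Finset.range (zetaZeroCount (T + 3))).filter fun n ↦
      b ≤ zetaOrdinate n ∧ zetaOrdinate n ≤ b + 1).card : ℝ) ≤ B' := fun b ↦ (hunit T hT1' b).trans (le_max_left _ _)
  have hkeyT := hkey T hTK
  have hfinT := hfin T R ρ B' (CK * T * Real.log T) hR1 hρ0 hρ1 hB' hT3 hL1 hRT hunit' hkeyT (by positivity)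
  have htrunc := norm_zeroSideSum_sub_sum_boxP_le (k := k) hΦi hC₀0 hC₀ hfar hCD hD hT0
  -- `‖S'‖ ≤ C₃ CK T L`
  have hS' : ‖sharpL Φ T‖ ≤ C₃ * (CK * T * Real.log T) := by
    unfold sharpL
    calc ‖∑ m ∈ box k (zetaZeroCount T), fT Φ T m‖ ≤ ∑ m ∈ box k (zetaZeroCount T), ‖fT Φ T m‖ := norm_sum_le _ _
      _ ≤ ∑ m ∈ boxP k T, ‖fT Φ T m‖ :=
          Finset.sum_le_sum_of_subset_of_nonneg (box_subset_boxP T) fun m _ _ ↦ norm_nonneg _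
      _ ≤ ∑ m ∈ boxP k T, C₃ * ∏ i : Fin k, w3 T (m 0) (m i.succ) :=
          Finset.sum_le_sum fun m _ ↦ (hC₃ T hL0 m).trans (le_of_eq (by simp only [w3_eq]))
      _ = C₃ * ∑ m ∈ boxP k T, ∏ i : Fin k, w3 T (m 0) (m i.succ) := by rw [Finset.mul_sum]
      _ ≤ C₃ * (CK * T * Real.log T) := mul_le_mul_of_nonneg_left hkeyT hC₃0
  -- combine
  have hmain : ‖zeroSideSum Φ T - (cLim k : ℂ) * sharpL Φ T‖ ≤
      ‖zeroSideSum Φ T - ∑ m ∈ boxP k T, fT Φ T m * (KT T m : ℂ)‖ +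
      ‖(∑ m ∈ boxP k T, fT Φ T m * (KT T m : ℂ)) - (cR k R : ℂ) * sharpL Φ T‖ +
      ‖((cR k R : ℂ) - cLim k) * sharpL Φ T‖ := by
    have e : zeroSideSum Φ T - (cLim k : ℂ) * sharpL Φ T =
        (zeroSideSum Φ T - ∑ m ∈ boxP k T, fT Φ T m * (KT T m : ℂ)) +
        ((∑ m ∈ boxP k T, fT Φ T m * (KT T m : ℂ)) - (cR k R : ℂ) * sharpL Φ T) +
        ((cR k R : ℂ) - cLim k) * sharpL Φ T := by ring
    rw [e]
    exact (norm_add_le _ _).trans (add_le_add (norm_add_le _ _) le_rfl)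
  refine hmain.trans ?_
  have h3 : ‖((cR k R : ℂ) - cLim k) * sharpL Φ T‖ ≤ e₂ * (C₃ * (CK * T * Real.log T)) := by
    rw [norm_mul, ← Complex.ofReal_sub, Complex.norm_real, Real.norm_eq_abs]
    exact mul_le_mul hRc hS' (norm_nonneg _) he₂.le
  have h2 : ‖(∑ m ∈ boxP k T, fT Φ T m * (KT T m : ℂ)) - (cR k R : ℂ) * sharpL Φ T‖ ≤
      A * (CK * T * Real.log T) * ((1 + Real.log T * ρ / (2 * π))⁻¹ +
        (ker 0 ^ k * (2 * kerC / R) + 2 * R * ((k + 1) * ker 0 ^ k * (ker 0 / 4 * ρ)))) + A * R * B' ^ (k + 1) := hfinT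
  -- numeric bookkeeping
  have hTL : 0 ≤ T * Real.log T := by positivity
  -- (a) `(1 + Lρ/2π)^{-1}` term
  have ha : A * (CK * T * Real.log T) * (1 + Real.log T * ρ / (2 * π))⁻¹ ≤ ε / 8 * (T * Real.log T) := by
    have : A * (CK * T * Real.log T) * (1 + Real.log T * ρ / (2 * π))⁻¹ = (A * CK * (1 + Real.log T * ρ / (2 * π))⁻¹) * (T * Real.log T) := by ring
    rw [this]; exact mul_le_mul_of_nonneg_right hE1 hTL
  -- (b) window tails `κ(0)^k 2C_κ/R ≤ e₁`
  have hb : A * (CK * T * Real.log T) * (ker 0 ^ k * (2 * kerC / R)) ≤ ε / 8 * (T * Real.log T) := by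
    have h1 : A * CK * (ker 0 ^ k * (2 * kerC / R)) ≤ (A * CK + 1) * e₁ := by
      calc A * CK * (ker 0 ^ k * (2 * kerC / R)) ≤ A * CK * e₁ := mul_le_mul_of_nonneg_left hRtail (by positivity)
        _ ≤ (A * CK + 1) * e₁ := by nlinarith
    have h2 : (A * CK + 1) * e₁ = ε / 8 := by simp only [e₁]; field_simp
    have : A * (CK * T * Real.log T) * (ker 0 ^ k * (2 * kerC / R)) = (A * CK * (ker 0 ^ k * (2 * kerC / R))) * (T * Real.log T) := by ring
    rw [this]
    exact mul_le_mul_of_nonneg_right (by linarith) hTL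
  -- (c) the `ρ` term
  have hc : A * (CK * T * Real.log T) * (2 * R * ((k + 1) * ker 0 ^ k * (ker 0 / 4 * ρ))) ≤ ε / 8 * (T * Real.log T) := by
    have h1 : A * CK * (2 * R * ((k + 1) * ker 0 ^ k * (ker 0 / 4 * ρ))) ≤ ρ * q := by
      have e : A * CK * (2 * R * ((k + 1) * ker 0 ^ k * (ker 0 / 4 * ρ))) =
          ρ * (A * CK * (2 * R * ((k + 1) * ker 0 ^ k * (ker 0 / 4)))) := by ring
      rw [e]
      refine mul_le_mul_of_nonneg_left ?_ hρ0.le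
      simp only [q]
      linarith
    have : A * (CK * T * Real.log T) * (2 * R * ((k + 1) * ker 0 ^ k * (ker 0 / 4 * ρ))) =
        (A * CK * (2 * R * ((k + 1) * ker 0 ^ k * (ker 0 / 4 * ρ)))) * (T * Real.log T) := by ring
    rw [this]
    exact mul_le_mul_of_nonneg_right (h1.trans hρq) hTL
  -- (d) boundary count
  have hd : A * R * B' ^ (k + 1) ≤ ε / 4 * (T * Real.log T) := by
    have h0 : 0 ≤ ε / 8 * (T * Real.log T) := by positivity
    rcases le_or_gt 1 B with hB | hB
    · have : B' = B := max_eq_left hB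
      rw [this]; linarith [hE2, show ε / 8 * T * Real.log T = ε / 8 * (T * Real.log T) by ring]
    · have : B' = 1 := max_eq_right hB.le
      rw [this, one_pow, mul_one]
      linarith [hE4, show ε / 8 * T * Real.log T = ε / 8 * (T * Real.log T) by ring]
  -- (f) truncation
  have hf : ‖zeroSideSum Φ T - ∑ m ∈ boxP k T, fT Φ T m * (KT T m : ℂ)‖ ≤ ε / 8 * (T * Real.log T) := by
    refine htrunc.trans ?_
    linarith [hE3, show ε / 8 * T * Real.log T = ε / 8 * (T * Real.log T) by ring]
  -- (g) `c(R) → c`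
  have hg : e₂ * (C₃ * (CK * T * Real.log T)) ≤ ε / 8 * (T * Real.log T) := by
    have h1 : e₂ * (C₃ * CK) ≤ ε / 8 := by
      have : e₂ * (C₃ * CK + 1) = ε / 8 := by simp only [e₂]; field_simp
      nlinarith [he₂.le]
    have : e₂ * (C₃ * (CK * T * Real.log T)) = (e₂ * (C₃ * CK)) * (T * Real.log T) := by ring
    rw [this]; exact mul_le_mul_of_nonneg_right h1 hTL
  have h2' : A * (CK * T * Real.log T) * ((1 + Real.log T * ρ / (2 * π))⁻¹ +
      (ker 0 ^ k * (2 * kerC / R) + 2 * R * ((k + 1) * ker 0 ^ k * (ker 0 / 4 * ρ)))) + A * R * B' ^ (k + 1) ≤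
      (5 * (ε / 8)) * (T * Real.log T) := by
    have e : A * (CK * T * Real.log T) * ((1 + Real.log T * ρ / (2 * π))⁻¹ +
        (ker 0 ^ k * (2 * kerC / R) + 2 * R * ((k + 1) * ker 0 ^ k * (ker 0 / 4 * ρ)))) + A * R * B' ^ (k + 1) =
        A * (CK * T * Real.log T) * (1 + Real.log T * ρ / (2 * π))⁻¹ +
        A * (CK * T * Real.log T) * (ker 0 ^ k * (2 * kerC / R)) +
        A * (CK * T * Real.log T) * (2 * R * ((k + 1) * ker 0 ^ k * (ker 0 / 4 * ρ))) + A * R * B' ^ (k + 1) := by ring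
    rw [e]
    linarith [ha, hb, hc, hd]
  have htotal : ‖zeroSideSum Φ T - ∑ m ∈ boxP k T, fT Φ T m * (KT T m : ℂ)‖ +
      ‖(∑ m ∈ boxP k T, fT Φ T m * (KT T m : ℂ)) - (cR k R : ℂ) * sharpL Φ T‖ +
      ‖((cR k R : ℂ) - cLim k) * sharpL Φ T‖ ≤ (7 * (ε / 8)) * (T * Real.log T) := by
    linarith [hf, h2.trans h2', h3.trans hg]
  refine htotal.trans ?_
  have : 7 * (ε / 8) * (T * Real.log T) ≤ ε * (T * Real.log T) := by nlinarith
  linarith [show ε * T * Real.log T = ε * (T * Real.log T) by ring]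

end Unsmooth

end RudnickSarnakN

end Literature.NumberTheory.LFunctions

end
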